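import Literature.AlgebraicGeometry.Frobenioids.GroupLikeEquivalenceProofs
import Literature.AlgebraicGeometry.Frobenioids.RigiditySlimness
import Literature.AlgebraicGeometry.Frobenioids.BaseSquareUniqueness
import Mathlib.CategoryTheory.Whiskering
import HarnessLib

/-!
# Frobenioids I, §3: proofs of the category-theoreticity facts — Proposition 3.11 (iii)

Mochizuki, *The geometry of Frobenioids I: the general theory*, Kyushu J. Math. **62** (2008),
Prop. 3.11 (iii), statement kurims p. 73, proof p. 74 [cite: MochizukiFrdI2008, Prop. 3.11 (iii) p.73]:
in the setting of Prop. 3.11, if `Ψ` and a quasi-inverse preserve base-identity endomorphisms, there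
is a `1`-unique functor `Ψ^Base : D₁ → D₂` with `Ψ^Base ∘ Base₁ ≅ Base₂ ∘ Ψ` (horizontal arrows
equivalences); if `D₁`, `D₂` are slim the composite functors are rigid.

PROOF-ONLY (seat abc-iut-L1-t13, D-ζ-a): the (iii)-half `FrdI.prop311iii_ofFunctor` and the named
fact `FrdI.Prop311ii_iii_holds` (= (ii) ∧ (iii), the (ii)-half being `FrdI.prop311ii_ofFunctor`).
Construction (p. 74, "`D_i` may be reconstructed from `C_i` by considering equivalence classes of
morphisms … modulo `N_{≥1}`-endomorphisms"): choose for every object of `D₁` a lift to `C₁`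
(Def. 1.3 (i)(a)) and for every arrow of `D₁` its unique lift of Frobenius degree `1` (Prop. 3.11 (i));
this is a functor `T : D₁ → C₁` with `Base₁ ∘ T ≅ id`, and `Ψ^Base := Base₂ ∘ Ψ ∘ T`. The square
commutes up to the base-isomorphisms `Ψ(ε_A)`, `ε_A : T(Base A) → A` the degree-`1` lift of the
identity — naturality holds because the discrepancy is an `N_{≥1}`-endomorphism, killed by `Base₂ ∘ Ψ`
by hypothesis; `Ψ^Base` is full, faithful and essentially surjective by Prop. 3.11 (i), (ii);
`1`-uniqueness by whiskering with `Base₁ ∘ T ≅ id`; rigidity from Prop. 1.13 (i) (seat abc-iut-L1-t1's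
`isRigidFunctor_baseFunctor`) transported along the equivalence and the square. No statement is
restated or strengthened.
-/

-- `(ofFunctor Φ F).base = baseFunctor F`, `Ψ.symm.functor = Ψ.inverse`, unit components: default transparency.
set_option backward.isDefEq.respectTransparency false

namespace Literature.AlgebraicGeometry.Frobenioids

open CategoryTheory Opposite

universe w v v' u u'

namespace FrdI

section Two

variable {D₁ : Type u} [Category.{v} D₁] {Φ₁ : D₁ᵒᵖ ⥤ CommMonCat.{w}} {C₁ : Type u'}
  [Category.{v'} C₁] {D₂ : Type u} [Category.{v} D₂] {Φ₂ : D₂ᵒᵖ ⥤ CommMonCat.{w}} {C₂ : Type u'}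
  [Category.{v'} C₂] {F₁ : C₁ ⥤ ElemFrobenioid Φ₁} {F₂ : C₂ ⥤ ElemFrobenioid Φ₂}

/-- **Prop. 3.11 (iii)** over the cell's definitions: the `1`-unique functor `Ψ^Base : D₁ ⥤ D₂` and the
rigidity of the composites of the square for slim `D₁`, `D₂`. [cite: MochizukiFrdI2008, Prop. 3.11 (iii) p.73] -/
theorem prop311iii_ofFunctor (hF₁ : PreFrobenioid.IsFrobenioid F₁) (hF₂ : PreFrobenioid.IsFrobenioid F₂)
    (Ψ : C₁ ≌ C₂) :
    (PreFrobenioidData.ofFunctor Φ₁ F₁).Prop311iii (PreFrobenioidData.ofFunctor Φ₂ F₂) Ψ := by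
  intro hs₁ hs₂ hΨ hΨ'
  -- the setting
  have hz₁ : ∀ (X : D₁) (x : Φ₁.obj (op X)), x = 1 := hs₁.zero
  have hz₂ : ∀ (X : D₂) (x : Φ₂.obj (op X)), x = 1 := hs₂.zero
  have hi₁ : ∀ A : C₁, PreFrobenioid.IsIsotropic F₁ A := fun A =>
    (PreFrobenioidData.ofFunctor_isIsotropic F₁ A).1 (hs₁.isotropic.obj A)
  have hi₂ : ∀ A : C₂, PreFrobenioid.IsIsotropic F₂ A := fun A =>
    (PreFrobenioidData.ofFunctor_isIsotropic F₂ A).1 (hs₂.isotropic.obj A)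
  have hu₁ : ∀ A : C₁, PreFrobenioid.unitsSubgroup F₁ A = ⊥ := fun A => hs₁.unitTrivial.obj A
  have hu₂ : ∀ A : C₂, PreFrobenioid.unitsSubgroup F₂ A = ⊥ := fun A => hs₂.unitTrivial.obj A
  -- Prop. 3.11 (ii): `Ψ` preserves base-isomorphisms and linear morphisms, `Ψ⁻¹` linear morphisms
  obtain ⟨hBI, -, hLin, -⟩ := prop311ii_ofFunctor hF₁ hF₂ Ψ hs₁ hs₂
  obtain ⟨-, -, hLin', -⟩ := prop311ii_ofFunctor hF₂ hF₁ Ψ.symm hs₂ hs₁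
  -- lifts of objects (Def. 1.3 (i)(a)) and degree-one lifts of arrows (Prop. 3.11 (i))
  have hσ : ∀ X : D₁, ∃ (A : C₁) (_ : PreFrobenioid.baseObj F₁ A ≅ X), True := fun X => by
    obtain ⟨A, -, ⟨i⟩⟩ := hF₁.i_a X
    exact ⟨A, i, trivial⟩
  choose σ ι _ using hσ
  have hl : ∀ (A B : C₁) (f : PreFrobenioid.baseObj F₁ A ⟶ PreFrobenioid.baseObj F₁ B),
      ∃ φ : A ⟶ B, PreFrobenioid.Base F₁ φ = f ∧ PreFrobenioid.degFr F₁ φ = 1 :=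
    fun A B f => exists_hom_of_base_degFr hF₁ hz₁ hi₁ A B f 1
  choose lift hlb hld using hl
  have huniq : ∀ {A B : C₁} (f : PreFrobenioid.baseObj F₁ A ⟶ PreFrobenioid.baseObj F₁ B) (φ : A ⟶ B),
      PreFrobenioid.Base F₁ φ = f → PreFrobenioid.degFr F₁ φ = 1 → φ = lift A B f :=
    fun f φ hb hd => eq_of_base_degFr_eq hF₁ hz₁ hi₁ hu₁ φ _ (hb.trans (hlb _ _ f).symm)
      (hd.trans (hld _ _ f).symm)
  -- the section functor `T : D₁ ⥤ C₁`
  let T : D₁ ⥤ C₁ :=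
    { obj := σ
      map := fun {X Y} f => lift (σ X) (σ Y) ((ι X).hom ≫ f ≫ (ι Y).inv)
      map_id := fun X => (huniq _ (𝟙 (σ X))
        (by rw [PreFrobenioid.base_id, Category.id_comp, Iso.hom_inv_id]) (PreFrobenioid.degFr_id F₁ _)).symm
      map_comp := fun {X Y Z} f g => (huniq _ (_ ≫ _)
        (by rw [PreFrobenioid.base_comp, hlb, hlb]; simp) (by rw [PreFrobenioid.degFr_comp, hld, hld, mul_one])).symm }
  have hTmap : ∀ {X Y : D₁} (f : X ⟶ Y), T.map f = lift (σ X) (σ Y) ((ι X).hom ≫ f ≫ (ι Y).inv) :=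
    fun f => rfl
  -- `ε_A : T (Base A) ⟶ A`, the degree-one lift of `ι`
  have hεB : ∀ A : C₁, PreFrobenioid.IsBaseIso F₁ (lift (σ (PreFrobenioid.baseObj F₁ A)) A (ι _).hom) := by
    intro A
    change IsIso (PreFrobenioid.Base F₁ _)
    rw [hlb]
    infer_instance
  have hΨε : ∀ A : C₁, IsIso (PreFrobenioid.Base F₂ (Ψ.functor.map
      (lift (σ (PreFrobenioid.baseObj F₁ A)) A (ι _).hom))) := fun A => hBI _ (hεB A)
  -- naturality of the square: the discrepancy is an `N_{≥1}`-endomorphism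
  have hnat : ∀ {A B : C₁} (φ : A ⟶ B),
      PreFrobenioid.Base F₂ (Ψ.functor.map (T.map (PreFrobenioid.Base F₁ φ))) ≫
          PreFrobenioid.Base F₂ (Ψ.functor.map (lift (σ (PreFrobenioid.baseObj F₁ B)) B (ι _).hom)) =
        PreFrobenioid.Base F₂ (Ψ.functor.map (lift (σ (PreFrobenioid.baseObj F₁ A)) A (ι _).hom)) ≫
          PreFrobenioid.Base F₂ (Ψ.functor.map φ) := by
    intro A B φ
    obtain ⟨τ, hτb, hτd⟩ :=
      exists_hom_of_base_degFr hF₁ hz₁ hi₁ B B (𝟙 _) (PreFrobenioid.degFr F₁ φ)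
    have hτ : PreFrobenioid.Base F₂ (Ψ.functor.map τ) = 𝟙 _ := hΨ B τ hτb
    have key : T.map (PreFrobenioid.Base F₁ φ) ≫ lift _ B (ι _).hom ≫ τ = lift _ A (ι _).hom ≫ φ := by
      apply eq_of_base_degFr_eq hF₁ hz₁ hi₁ hu₁
      · rw [PreFrobenioid.base_comp, PreFrobenioid.base_comp, PreFrobenioid.base_comp, hTmap, hlb, hlb,
          hlb, hτb, Category.comp_id, Category.assoc, Category.assoc, Iso.inv_hom_id, Category.comp_id]
      · rw [PreFrobenioid.degFr_comp, PreFrobenioid.degFr_comp, PreFrobenioid.degFr_comp, hTmap, hld, hld,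
          hld, hτd]
        simp only [one_mul]
    have := congrArg (fun χ => PreFrobenioid.Base F₂ (Ψ.functor.map χ)) key
    simp only [Functor.map_comp, PreFrobenioid.base_comp, hτ, Category.comp_id] at this
    exact this
  -- the functor and the square
  let ΨBase : D₁ ⥤ D₂ := T ⋙ (Ψ.functor ⋙ PreFrobenioid.baseFunctor F₂)
  let esq : PreFrobenioid.baseFunctor F₁ ⋙ ΨBase ≅ Ψ.functor ⋙ PreFrobenioid.baseFunctor F₂ :=
    NatIso.ofComponents
      (fun A => asIso (PreFrobenioid.Base F₂ (Ψ.functor.map (lift (σ (PreFrobenioid.baseObj F₁ A)) A (ι _).hom))))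
      (fun {A B} φ => hnat φ)
  -- `Base₁ ∘ T ≅ id`
  let eT : T ⋙ PreFrobenioid.baseFunctor F₁ ≅ 𝟭 D₁ :=
    NatIso.ofComponents (fun X => ι X) (fun {X Y} f => by
      change PreFrobenioid.Base F₁ (T.map f) ≫ (ι Y).hom = (ι X).hom ≫ f
      rw [hTmap, hlb, Category.assoc, Category.assoc, Iso.inv_hom_id, Category.comp_id])
  refine ⟨ΨBase, ⟨?_, ⟨esq.symm⟩, fun B' hB' => ?_⟩, fun hD₁ hD₂ => ?_⟩
  · -- `ΨBase` is an equivalence: faithful, full, essentially surjective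
    refine Functor.IsEquivalence.mk (faithful := ⟨fun {X Y} f f' h => ?_⟩) (full := ⟨fun {X Y} g => ?_⟩)
      (essSurj := ⟨fun Z => ?_⟩)
    · change PreFrobenioid.Base F₂ (Ψ.functor.map (T.map f)) =
        PreFrobenioid.Base F₂ (Ψ.functor.map (T.map f')) at h
      have h1 : Ψ.functor.map (T.map f) = Ψ.functor.map (T.map f') :=
        eq_of_base_degFr_eq hF₂ hz₂ hi₂ hu₂ _ _ h
          ((hLin _ (by rw [hTmap]; exact hld _ _ _)).trans (hLin _ (by rw [hTmap]; exact hld _ _ _)).symm)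
      have h2 := congrArg (PreFrobenioid.Base F₁) (Ψ.functor.map_injective h1)
      rw [hTmap, hTmap, hlb, hlb] at h2
      simpa using h2
    · obtain ⟨χ, hχb, hχd⟩ := exists_hom_of_base_degFr hF₂ hz₂ hi₂ (Ψ.functor.obj (σ X)) (Ψ.functor.obj (σ Y)) g 1
      have h1 : PreFrobenioid.IsLinear F₁ (Ψ.inverse.map χ) := hLin' χ hχd
      have h2 : Ψ.unit.app _ ≫ Ψ.inverse.map χ ≫ Ψ.unitInv.app _ = Ψ.functor.preimage χ := by
        rw [← Ψ.functor.map_preimage χ, Ψ.inv_fun_map]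
        simp
      have h3 : PreFrobenioid.IsLinear F₁ (Ψ.functor.preimage χ) := by
        rw [← h2]
        exact PreFrobenioid.IsLinear.comp F₁ (PreFrobenioid.isLinear_of_isIso F₁ _)
          (PreFrobenioid.IsLinear.comp F₁ h1 (PreFrobenioid.isLinear_of_isIso F₁ _))
      refine ⟨(ι X).inv ≫ PreFrobenioid.Base F₁ (Ψ.functor.preimage χ) ≫ (ι Y).hom, ?_⟩
      change PreFrobenioid.Base F₂ (Ψ.functor.map (T.map _)) = g
      rw [hTmap, ← huniq _ (Ψ.functor.preimage χ) (by simp) h3, Ψ.functor.map_preimage, hχb]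
    · obtain ⟨B, -, ⟨j⟩⟩ := hF₂.i_a Z
      let A : C₁ := Ψ.inverse.obj B
      haveI := hΨε A
      exact ⟨PreFrobenioid.baseObj F₁ A,
        ⟨asIso (PreFrobenioid.Base F₂ (Ψ.functor.map (lift (σ (PreFrobenioid.baseObj F₁ A)) A (ι _).hom))) ≪≫
          (PreFrobenioid.baseFunctor F₂).mapIso (Ψ.counitIso.app B) ≪≫ j⟩⟩
  · -- `1`-uniqueness: whisker the given square with `Base₁ ∘ T ≅ id`
    obtain ⟨θ⟩ := hB'
    exact ⟨B'.leftUnitor.symm ≪≫ Functor.isoWhiskerRight eT.symm B' ≪≫ Functor.associator _ _ _ ≪≫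
      Functor.isoWhiskerLeft T θ.symm⟩
  · -- rigidity for slim bases (Prop. 1.13 (i))
    have h1 : IsRigidFunctor (Ψ.functor ⋙ PreFrobenioid.baseFunctor F₂) :=
      IsRigidFunctor.equivalence_comp Ψ (PreFrobenioid.isRigidFunctor_baseFunctor hF₂ hD₂)
    exact ⟨h1, PreFrobenioidData.isRigidFunctor_congr esq.symm h1⟩

/-! ### The named fact, discharged -/

/-- **[FrdI] Proposition 3.11 (ii), (iii) — DISCHARGED**: in the setting of Prop. 3.11 (`Φ_i = 0`,
`D_i` of FSMFF-type, `C_i` of isotropic, unit-trivial and group-like type), an equivalence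
`Ψ : C₁ ⥲ C₂` preserves base-isomorphisms, pull-back morphisms, linear morphisms and morphisms of
Frobenius type; and if `Ψ`, `Ψ⁻¹` preserve base-identity endomorphisms there is a `1`-unique
`Ψ^Base : D₁ → D₂` `1`-commuting with the projections, with rigid composites for slim `D₁`, `D₂`
(kurims p. 73, proof pp. 73–74). [cite: MochizukiFrdI2008, Prop. 3.11 (ii) p.73] -/
theorem Prop311ii_iii_holds : Prop311ii_iii.{w, v, v', u, u'} := by
  intro D₁ _ Φ₁ C₁ _ D₂ _ Φ₂ C₂ _ F₁ F₂ hF₁ hF₂ Ψ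
  exact ⟨prop311ii_ofFunctor hF₁ hF₂ Ψ, prop311iii_ofFunctor hF₁ hF₂ Ψ⟩

end Two

end FrdI

end Literature.AlgebraicGeometry.Frobenioids
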